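import Mathlib
import Literature.Computability.AlgebraicComplexity.PermanentIrreducible
import Literature.Computability.AlgebraicComplexity.StandardFamiliesProofs

/-!
# Crux `DivisionGap.PerCofactorDegreeReduction` (stmt-ValiantsHypothesis-15046), line `Sketch` —
# stub `stub_negativeCompensation`: how a negative coefficient of a signed cofactor hides

**Theorem (`stub_negativeCompensation`).** Let `q ∈ ℝ[x_ij]` (`n × n` variables) and suppose
every coefficient of `per_n · q` is nonnegative.  If `q_m < 0`, then for EVERY permutation `σ`
there is a second permutation `τ ≠ σ` with `μ_τ ≤ m + μ_σ` and `q_{m + μ_σ − μ_τ} > 0`.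

## Proof

With `per_n = Σ_τ x^{μ_τ}` (`perPoly_eq_sum_monomial`) and `MvPolynomial.coeff_monomial_mul'`,
the coefficient of `per_n · q` at an exponent `d` is
`Σ_τ [μ_τ ≤ d] · q_{d − μ_τ}` (`coeff_perPoly_mul`).  At `d = m + μ_σ` this is `≥ 0` by hypothesis,
and its `τ = σ` term is `q_{m + μ_σ − μ_σ} = q_m < 0` (`add_tsub_cancel_right`).  Hence the sum of
the remaining terms, over `τ ≠ σ`, is strictly positive (`Finset.add_sum_erase`), so one of them is
strictly positive (`Finset.exists_lt_of_sum_lt`); a strictly positive term has `μ_τ ≤ m + μ_σ`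
(otherwise it vanishes) and equals `q_{m + μ_σ − μ_τ}`.

This is the mechanism behind the threshold `d*(n) = n + 2` of `stub_automaticPositivity` (sharp
example `per₂ · (a² − ab + b²) = a³ + b³`): a negative coefficient of the cofactor must be
compensated, against every permutation `σ`, by a second permutation inside `m + μ_σ`.

Design: no definitions; everything is over `Fin n` for all `n` (at `n = 0` there is only one
permutation and the hypotheses are contradictory, which the same argument detects).  Leans on
Mathlib and the tree file `Literature/Computability/AlgebraicComplexity/PermanentIrreducible.lean`
only.
-/

noncomputable section

-- `Summit.ValiantsHypothesis.ValiantsHypothesis.…` is the tree's mandated single-conjunct layout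
-- (Problem = Summit), so the duplicated namespace component is intended.
set_option linter.dupNamespace false

namespace Summit.ValiantsHypothesis.ValiantsHypothesis.Theorems.DivisionGap.PerCofactorDegreeReduction.NegativeCompensation

open MvPolynomial Literature.Computability.AlgebraicComplexity
open scoped BigOperators

variable {n : ℕ}

/-! ### Coefficients of `per_n · q` -/

/-- **Coefficients of a multiple of the permanent.**  For every exponent `d`,
`coeff d (per_n · q) = Σ_τ [μ_τ ≤ d] · coeff (d − μ_τ) q`: expand `per_n = Σ_τ x^{μ_τ}`
(`perPoly_eq_sum_monomial`) and use `coeff_monomial_mul'` termwise. [folklore] -/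
theorem coeff_perPoly_mul (d : (Fin n × Fin n) →₀ ℕ) (q : MvPolynomial (Fin n × Fin n) ℝ) :
    coeff d (perPoly (Fin n) ℝ * q) =
      ∑ τ : Equiv.Perm (Fin n), if permMonomial τ ≤ d then coeff (d - permMonomial τ) q else 0 := by
  rw [perPoly_eq_sum_monomial (n := Fin n) ℝ, Finset.sum_mul, coeff_sum]
  refine Finset.sum_congr rfl fun τ _ => ?_
  rw [coeff_monomial_mul']
  split_ifs with h
  · rw [one_mul]
  · rfl

/-- **Splitting off one permutation.**  For every exponent `m` and permutation `σ`,
`coeff (m + μ_σ) (per_n · q) = coeff m q + Σ_{τ ≠ σ} [μ_τ ≤ m + μ_σ] · coeff (m + μ_σ − μ_τ) q`: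
the `τ = σ` term of `coeff_perPoly_mul` is `coeff m q` since `μ_σ ≤ m + μ_σ` and
`m + μ_σ − μ_σ = m`. [folklore] -/
theorem coeff_add_permMonomial_perPoly_mul (m : (Fin n × Fin n) →₀ ℕ)
    (q : MvPolynomial (Fin n × Fin n) ℝ) (σ : Equiv.Perm (Fin n)) :
    coeff (m + permMonomial σ) (perPoly (Fin n) ℝ * q) =
      coeff m q + ∑ τ ∈ Finset.univ.erase σ,
        if permMonomial τ ≤ m + permMonomial σ then
          coeff (m + permMonomial σ - permMonomial τ) q else 0 := by
  rw [coeff_perPoly_mul, ← Finset.add_sum_erase _ _ (Finset.mem_univ σ), if_pos le_add_self,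
    add_tsub_cancel_right]

/-! ### The stub -/

/-- **stub_negativeCompensation — how a signed cofactor hides.**  If `per_n · q ≥ 0`
coefficientwise and `q_m < 0`, then for EVERY permutation `σ` there is a second permutation
`τ ≠ σ` with `μ_τ ≤ m + μ_σ` and `q_{m + μ_σ − μ_τ} > 0`: the coefficient
`(per_n · q)_{m + μ_σ} = Σ_τ [μ_τ ≤ m + μ_σ] q_{m + μ_σ − μ_τ} ≥ 0` contains the negative term
`τ = σ` (`coeff_add_permMonomial_perPoly_mul`), so the sum over `τ ≠ σ` is strictly positive and
has a strictly positive summand (`Finset.exists_lt_of_sum_lt`), whose guard `μ_τ ≤ m + μ_σ` must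
hold.  This is the mechanism behind the threshold `d*(n) = n + 2` of `stub_automaticPositivity`.
[prime-walk-positivizer, Why (1)/(4)] -/
theorem stub_negativeCompensation (n : ℕ) (q : MvPolynomial (Fin n × Fin n) ℝ)
    (hpos : ∀ m, 0 ≤ coeff m (perPoly (Fin n) ℝ * q))
    (m : (Fin n × Fin n) →₀ ℕ) (hm : coeff m q < 0) (σ : Equiv.Perm (Fin n)) :
    ∃ τ : Equiv.Perm (Fin n), τ ≠ σ ∧ permMonomial τ ≤ m + permMonomial σ ∧
      0 < coeff (m + permMonomial σ - permMonomial τ) q := by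
  have h := hpos (m + permMonomial σ)
  rw [coeff_add_permMonomial_perPoly_mul] at h
  -- the sum over `τ ≠ σ` is strictly positive
  have hsum : ∑ _τ ∈ Finset.univ.erase σ, (0 : ℝ) < ∑ τ ∈ Finset.univ.erase σ,
      (if permMonomial τ ≤ m + permMonomial σ then
        coeff (m + permMonomial σ - permMonomial τ) q else 0) := by
    rw [Finset.sum_const_zero]
    linarith
  -- hence it has a strictly positive summand
  obtain ⟨τ, hτ, hτpos⟩ := Finset.exists_lt_of_sum_lt hsum
  refine ⟨τ, Finset.ne_of_mem_erase hτ, ?_⟩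
  by_cases hle : permMonomial τ ≤ m + permMonomial σ
  · rw [if_pos hle] at hτpos
    exact ⟨hle, hτpos⟩
  · rw [if_neg hle] at hτpos
    exact absurd hτpos (lt_irrefl 0)

end Summit.ValiantsHypothesis.ValiantsHypothesis.Theorems.DivisionGap.PerCofactorDegreeReduction.NegativeCompensation

end
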